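import Summits.QuantumFields.YangMills.Theorems.SmallCircleAnchorAnchorGapDefectsDiluteEx
import Summits.QuantumFields.YangMills.Theorems.SmallCircleAnchorAnchorGapStubPinningTransfer

/-!
# Dilute holonomy defects at strong pinning — the quotable form (crux `AnchorGap`)

Helper for crux stmt-QuantumFields-11141 (`AnchorGap`, route `SmallCircleAnchor`), line
independent: `dilute_defects_of_pinning` (registered sub-goal). For an abelianising `V`
(continuous class function minimised exactly on `Cl(g₀)`), every conjugation-invariant open
neighbourhood `U₀` of the class and every `ε₀ > 0` there is a pinning threshold `s₀` such that for
all `s ≥ s₀`, ALL `β`, `T`, `L` and all finite sets `K` of spatial sites,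
`Ex (∏_{x∈K} 1_{U₀ᶜ}(P_x)) ≤ (e^{12N|β|} ε₀)^{|K|}` in the crux functional: holonomy defects are a
dilute field dominated by a Bernoulli product of density `e^{12N|β|} ε₀`, uniformly in the
volume — the large-field input for the holonomy sector of `stub_abelianisation`
(`exists_pinningStrength`, p147343, feeds `holonomy_defects_dilute_Ex`, p155605).
-/

set_option autoImplicit false

noncomputable section

namespace Summit.QuantumFields.YangMills.Theorems.AnchorGap

open MeasureTheory
open Literature.MathematicalPhysics.QuantumFieldTheory

namespace Defects

/-- **Dilute holonomy defects at strong pinning** (registered sub-goal of crux `AnchorGap`):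
`Ex (∏_{x∈K} 1_{U₀ᶜ}(P_x U)) ≤ (e^{12N|β|} ε₀)^{|K|}` for all `s ≥ s₀(V, U₀, ε₀)`, uniformly in
`β`, `T`, `L`, `K`. [folklore] -/
theorem dilute_defects_of_pinning :
    ∀ (G : Type) [Group G] [TopologicalSpace G] [IsTopologicalGroup G] [CompactSpace G], letI : MeasurableSpace G := borel G; haveI : BorelSpace G := ⟨rfl⟩; ∀ (r : LatticeRep G) (V : G → ℝ) (g₀ : G), Continuous V → (∀ a g : G, V (a * g * a⁻¹) = V g) → (∀ g : G, V g₀ ≤ V g) → (∀ g : G, V g = V g₀ → ∃ a : G, g = a * g₀ * a⁻¹) → ∀ (U₀ : Set G), IsOpen U₀ → (∀ a g : G, a * g * a⁻¹ ∈ U₀ ↔ g ∈ U₀) → (∀ a : G, a * g₀ * a⁻¹ ∈ U₀) → ∀ ε₀ : ℝ, 0 < ε₀ → ∃ s₀ : ℝ, 0 ≤ s₀ ∧ ∀ s : ℝ, s₀ ≤ s → ∀ (T : ℕ) [NeZero T] (β : ℝ) (L : ℕ) [NeZero L], let St := ZMod T × (Fin 3 → ZMod L); let Cfg := St × Option (Fin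 3) → G; let ν : MeasureTheory.Measure Cfg := MeasureTheory.Measure.pi fun _ => haarProbability G; let sh : St → Option (Fin 3) → St := fun x μ => Option.elim μ (x.1 + 1, x.2) fun i => (x.1, x.2 + Pi.single i 1); let pl : Cfg → St → Option (Fin 3) → Option (Fin 3) → G := fun U x μ κ => U (x, μ) * U (sh x μ, κ) * (U (sh x κ, μ))⁻¹ * (U (x, κ))⁻¹; let act : Cfg → ℝ := fun U => β * ∑ x : St, ∑ i : Fin 3, (r.ρ (pl U x none (some i))).trace.re + β * ∑ x : St, ∑ q : {q : Fin 3 × Fin 3 // q.1 < q.2}, (r.ρ (pl U x (some q.1.1) (some q.1.2))).trace.re; let P : Cfg → (Fin 3 → ZMod L) → G := fun U x => (List.ofFn fun t : Fin T => U ((((t : ℕ) : ZMod T), x), none)).prod; let wgt : Cfg → ℝ := fun U => Real.exp (act U - s * ∑ x : Fin 3 → ZMod L, V (P U x)); let Ex : (Cfg → ℝ) → ℝ := fun F => (∫ U, F U * wgt U ∂ν) / (∫ U, wgt U ∂ν); ∀ (K : Finset (Fin 3 → ZMod L)), Ex (fun U => ∏ x ∈ K, U₀ᶜ.indicator (fun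 _ => (1 : ℝ)) (P U x)) ≤ (Real.exp (12 * r.N * |β|) * ε₀) ^ K.card := by
  intro G _ _ _ _
  letI : MeasurableSpace G := borel G
  haveI : BorelSpace G := ⟨rfl⟩
  intro r V g₀ hVc hVcl hmin huniq U₀ hU₀o hU₀conj hU₀g ε₀ hε₀
  haveI : (haarProbability G).IsOpenPosMeasure := by rw [haarProbability]; infer_instance
  obtain ⟨E₀, hE₀, hE⟩ := exists_pinningStrength (haarProbability G) hVc hmin huniq hU₀o hU₀g hε₀
  refine ⟨E₀, hE₀, fun s hs T _ β L _ => ?_⟩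
  intro St Cfg ν sh pl act P wgt Ex K
  have hDm : MeasurableSet U₀ᶜ := hU₀o.measurableSet.compl
  have hDconj : ∀ a g : G, a * g * a⁻¹ ∈ U₀ᶜ ↔ g ∈ U₀ᶜ := fun a g => by
    simp only [Set.mem_compl_iff, hU₀conj]
  have hb : Ex (fun U => ∏ x ∈ K, U₀ᶜ.indicator (fun _ => (1 : ℝ)) (P U x)) ≤
      (Real.exp (12 * r.N * |β|) * ((∫ g in U₀ᶜ, Real.exp (-(s * V g)) ∂haarProbability G) /
        (∫ g, Real.exp (-(s * V g)) ∂haarProbability G))) ^ K.card :=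
    holonomy_defects_dilute_Ex G r V hVcl hVc T β s L U₀ᶜ hDm hDconj K
  refine hb.trans (pow_le_pow_left₀ (mul_nonneg (Real.exp_pos _).le
    (div_nonneg (integral_nonneg fun g => (Real.exp_pos _).le)
      (integral_nonneg fun g => (Real.exp_pos _).le))) ?_ _)
  refine mul_le_mul_of_nonneg_left ?_ (Real.exp_pos _).le
  have hZ : 0 < ∫ g, Real.exp (-(s * V g)) ∂haarProbability G := by
    have hc : Continuous fun g => Real.exp (-(s * V g)) :=
      Real.continuous_exp.comp ((continuous_const.mul hVc).neg)
    obtain ⟨g₁, -, hg₁⟩ := isCompact_univ.exists_isMinOn Set.univ_nonempty hc.continuousOn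
    obtain ⟨g₂, -, hg₂⟩ := isCompact_univ.exists_isMaxOn Set.univ_nonempty hc.continuousOn
    exact (Real.exp_pos _).trans_le (le_integral_weight (haarProbability G) hc.measurable
      (fun g => hg₁ (Set.mem_univ g)) (fun g => hg₂ (Set.mem_univ g)))
  rw [div_le_iff₀ hZ]
  exact hE s hs


/-! ### Any open neighbourhood of the class -/

/-- **The conjugation core of an open set is open** (compact `G`): `{g | ∀ a, a g a⁻¹ ∈ U₀}` is open
when `U₀` is (generalised tube lemma over the compact group of conjugators; `(x, a) ↦ a x a⁻¹` is
continuous). [folklore] -/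
theorem isOpen_conjCore {G : Type} [Group G] [TopologicalSpace G] [IsTopologicalGroup G]
    [CompactSpace G] {U₀ : Set G} (hU₀ : IsOpen U₀) : IsOpen {g : G | ∀ a : G, a * g * a⁻¹ ∈ U₀} := by
  rw [isOpen_iff_mem_nhds]
  intro g hg
  have hcont : Continuous fun q : G × G => q.2 * q.1 * q.2⁻¹ :=
    (continuous_snd.mul continuous_fst).mul continuous_snd.inv
  have hev : ∀ a ∈ (Set.univ : Set G), ∀ᶠ q : G × G in nhds (g, a), q.2 * q.1 * q.2⁻¹ ∈ U₀ :=
    fun a _ => hcont.continuousAt.eventually_mem (hU₀.mem_nhds (hg a))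
  exact Filter.mem_of_superset (isCompact_univ.eventually_forall_of_forall_eventually hev)
    fun x hx a => hx a (Set.mem_univ a)

/-- **Dilute holonomy defects at strong pinning, for ANY open neighbourhood `U₀` of the class**
(registered sub-goal of crux `AnchorGap`): as `dilute_defects_of_pinning` without assuming `U₀`
conjugation invariant — apply it to the open conjugation core `W = {g | ∀ a, a g a⁻¹ ∈ U₀} ⊆ U₀`
(`isOpen_conjCore`; it contains the class and is conjugation invariant) and use `1_{U₀ᶜ} ≤ 1_{Wᶜ}`
with the monotonicity of the positive functional `Ex`. [folklore] -/
theorem dilute_defects_of_pinning_open :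
    ∀ (G : Type) [Group G] [TopologicalSpace G] [IsTopologicalGroup G] [CompactSpace G], letI : MeasurableSpace G := borel G; haveI : BorelSpace G := ⟨rfl⟩; ∀ (r : LatticeRep G) (V : G → ℝ) (g₀ : G), Continuous V → (∀ a g : G, V (a * g * a⁻¹) = V g) → (∀ g : G, V g₀ ≤ V g) → (∀ g : G, V g = V g₀ → ∃ a : G, g = a * g₀ * a⁻¹) → ∀ (U₀ : Set G), IsOpen U₀ → (∀ a : G, a * g₀ * a⁻¹ ∈ U₀) → ∀ ε₀ : ℝ, 0 < ε₀ → ∃ s₀ : ℝ, 0 ≤ s₀ ∧ ∀ s : ℝ, s₀ ≤ s → ∀ (T : ℕ) [NeZero T] (β : ℝ) (L : ℕ) [NeZero L], let St := ZMod T × (Fin 3 → ZMod L); let Cfg := St × Option (Fin 3) → G; let ν : MeasureTheory.Measure Cfg := MeasureTheory.Measure.pi fun _ => haarProbability G; let sh : St → Option (Fin 3) → St := fun x μ => Option.elim μ (x.1 + 1, x.2) fun i => (x.1, x.2 + Pi.single i 1); let pl : Cfg → St → Option (Fin 3) → Option (Fin 3) → G := fun U x μ κ => U (x, μ) * U (sh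 x μ, κ) * (U (sh x κ, μ))⁻¹ * (U (x, κ))⁻¹; let act : Cfg → ℝ := fun U => β * ∑ x : St, ∑ i : Fin 3, (r.ρ (pl U x none (some i))).trace.re + β * ∑ x : St, ∑ q : {q : Fin 3 × Fin 3 // q.1 < q.2}, (r.ρ (pl U x (some q.1.1) (some q.1.2))).trace.re; let P : Cfg → (Fin 3 → ZMod L) → G := fun U x => (List.ofFn fun t : Fin T => U ((((t : ℕ) : ZMod T), x), none)).prod; let wgt : Cfg → ℝ := fun U => Real.exp (act U - s * ∑ x : Fin 3 → ZMod L, V (P U x)); let Ex : (Cfg → ℝ) → ℝ := fun F => (∫ U, F U * wgt U ∂ν) / (∫ U, wgt U ∂ν); ∀ (K : Finset (Fin 3 → ZMod L)), Ex (fun U => ∏ x ∈ K, U₀ᶜ.indicator (fun _ => (1 : ℝ)) (P U x)) ≤ (Real.exp (12 * r.N * |β|) * ε₀) ^ K.card := by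
  intro G _ _ _ _
  letI : MeasurableSpace G := borel G
  haveI : BorelSpace G := ⟨rfl⟩
  intro r V g₀ hVc hVcl hmin huniq U₀ hU₀o hU₀g ε₀ hε₀
  set W : Set G := {g : G | ∀ a : G, a * g * a⁻¹ ∈ U₀} with hW
  have hWo : IsOpen W := isOpen_conjCore hU₀o
  have hWconj : ∀ a g : G, a * g * a⁻¹ ∈ W ↔ g ∈ W := by
    intro a g
    constructor
    · intro h c
      have := h (c * a⁻¹)
      simpa [mul_assoc] using this
    · intro h c
      have := h (c * a)
      simpa [mul_assoc] using this
  have hWg : ∀ a : G, a * g₀ * a⁻¹ ∈ W := by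
    intro a c
    have := hU₀g (c * a)
    simpa [mul_assoc] using this
  have hWU : W ⊆ U₀ := fun g hg => by simpa using hg 1
  obtain ⟨s₀, hs₀, hmain⟩ :=
    dilute_defects_of_pinning G r V g₀ hVc hVcl hmin huniq W hWo hWconj hWg ε₀ hε₀
  refine ⟨s₀, hs₀, fun s hs T _ β L _ => ?_⟩
  intro St Cfg ν sh pl act P wgt Ex K
  haveI : SecondCountableTopology G :=
    (r.continuous.isClosedEmbedding r.injective).isEmbedding.secondCountableTopology
  haveI hν : IsProbabilityMeasure ν := by
    show IsProbabilityMeasure (Measure.pi fun _ : St × Option (Fin 3) => haarProbability G)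
    infer_instance
  have hW' : Ex (fun U => ∏ x ∈ K, Wᶜ.indicator (fun _ => (1 : ℝ)) (P U x)) ≤
      (Real.exp (12 * r.N * |β|) * ε₀) ^ K.card := hmain s hs T β L K
  refine le_trans ?_ hW'
  -- the two defect observables: `0 ≤ F_U ≤ F_W ≤ 1`, measurable
  have hind : ∀ g : G, U₀ᶜ.indicator (fun _ => (1 : ℝ)) g ≤ Wᶜ.indicator (fun _ => (1 : ℝ)) g := by
    intro g
    by_cases hg : g ∈ U₀ᶜ
    · rw [Set.indicator_of_mem hg, Set.indicator_of_mem (show g ∈ Wᶜ from fun hw => hg (hWU hw))]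
    · rw [Set.indicator_of_notMem hg]
      exact Set.indicator_nonneg (fun _ _ => zero_le_one) g
  have hPc : ∀ x : Fin 3 → ZMod L, Continuous fun U : Cfg => P U x := by
    intro x
    show Continuous fun U : Cfg => (List.ofFn fun t : Fin T => U ((((t : ℕ) : ZMod T), x), none)).prod
    simp only [List.ofFn_eq_map]
    exact continuous_list_prod _ fun t _ => continuous_apply _
  have hmeas : ∀ D : Set G, MeasurableSet D →
      Measurable fun U : Cfg => ∏ x ∈ K, D.indicator (fun _ => (1 : ℝ)) (P U x) := fun D hD =>
    Finset.measurable_prod _ fun x _ => (measurable_const.indicator hD).comp (hPc x).measurable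
  have hb1 : ∀ (D : Set G) (U : Cfg), |∏ x ∈ K, D.indicator (fun _ => (1 : ℝ)) (P U x)| ≤ 1 := by
    intro D U
    rw [Finset.abs_prod]
    calc ∏ x ∈ K, |D.indicator (fun _ => (1 : ℝ)) (P U x)| ≤ ∏ _x ∈ K, (1 : ℝ) := by
          refine Finset.prod_le_prod (fun x _ => abs_nonneg _) fun x _ => ?_
          rw [abs_of_nonneg (Set.indicator_nonneg (fun _ _ => zero_le_one) _)]
          exact Set.indicator_le_self' (fun _ _ => zero_le_one) _
      _ = 1 := Finset.prod_const_one
  have hle : ∀ U : Cfg, ∏ x ∈ K, U₀ᶜ.indicator (fun _ => (1 : ℝ)) (P U x) ≤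
      ∏ x ∈ K, Wᶜ.indicator (fun _ => (1 : ℝ)) (P U x) := fun U =>
    Finset.prod_le_prod (fun x _ => Set.indicator_nonneg (fun _ _ => zero_le_one) _) fun x _ => hind _
  -- the weight: continuous, pinched
  have hplc : ∀ (x : St) (μ κ : Option (Fin 3)), Continuous fun U : Cfg => pl U x μ κ := by
    intro x μ κ
    show Continuous fun U : Cfg => U (x, μ) * U (sh x μ, κ) * (U (sh x κ, μ))⁻¹ * (U (x, κ))⁻¹
    exact (((continuous_apply (x, μ)).mul (continuous_apply (sh x μ, κ))).mul
      (continuous_apply (sh x κ, μ)).inv).mul (continuous_apply (x, κ)).inv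
  have htrc : ∀ (x : St) (μ κ : Option (Fin 3)),
      Continuous fun U : Cfg => (r.ρ (pl U x μ κ)).trace.re := fun x μ κ =>
    Complex.continuous_re.comp ((r.continuous.comp (hplc x μ κ)).matrix_trace)
  have hactc : Continuous act := by
    refine (continuous_const.mul (continuous_finsetSum _ fun x _ =>
      continuous_finsetSum _ fun i _ => htrc x none (some i))).add
      (continuous_const.mul (continuous_finsetSum _ fun x _ =>
        continuous_finsetSum _ fun q _ => htrc x (some q.1.1) (some q.1.2)))
  have hwc : Continuous wgt :=
    Real.continuous_exp.comp (hactc.sub (continuous_const.mul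
      (continuous_finsetSum _ fun x _ => hVc.comp (hPc x))))
  obtain ⟨U₁, -, hU₁⟩ := isCompact_univ.exists_isMinOn Set.univ_nonempty hwc.continuousOn
  obtain ⟨U₂, -, hU₂⟩ := isCompact_univ.exists_isMaxOn Set.univ_nonempty hwc.continuousOn
  have hwa : ∀ U, wgt U₁ ≤ wgt U := fun U => hU₁ (Set.mem_univ U)
  have hwb : ∀ U, wgt U ≤ wgt U₂ := fun U => hU₂ (Set.mem_univ U)
  have hwpos : 0 < wgt U₁ := Real.exp_pos _
  have hZ : 0 < ∫ U, wgt U ∂ν := hwpos.trans_le (le_integral_weight ν hwc.measurable hwa hwb)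
  have hint : ∀ D : Set G, MeasurableSet D →
      Integrable (fun U : Cfg => (∏ x ∈ K, D.indicator (fun _ => (1 : ℝ)) (P U x)) * wgt U) ν := by
    intro D hD
    refine integrable_of_abs_le ν ((hmeas D hD).mul hwc.measurable) (c := wgt U₂) fun U => ?_
    rw [abs_mul, abs_of_pos ((hwpos.trans_le (hwa U)))]
    calc |∏ x ∈ K, D.indicator (fun _ => (1 : ℝ)) (P U x)| * wgt U ≤ 1 * wgt U :=
          mul_le_mul_of_nonneg_right (hb1 D U) (hwpos.trans_le (hwa U)).le
      _ ≤ wgt U₂ := by rw [one_mul]; exact hwb U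
  show (∫ U, (∏ x ∈ K, U₀ᶜ.indicator (fun _ => (1 : ℝ)) (P U x)) * wgt U ∂ν) / (∫ U, wgt U ∂ν) ≤
    (∫ U, (∏ x ∈ K, Wᶜ.indicator (fun _ => (1 : ℝ)) (P U x)) * wgt U ∂ν) / (∫ U, wgt U ∂ν)
  refine div_le_div_of_nonneg_right (integral_mono (hint _ hU₀o.isClosed_compl.measurableSet)
    (hint _ hWo.isClosed_compl.measurableSet) fun U => ?_) hZ.le
  exact mul_le_mul_of_nonneg_right (hle U) (hwpos.trans_le (hwa U)).le

end Defects

end Summit.QuantumFields.YangMills.Theorems.AnchorGap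

end
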